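import Summits.ResolutionOfSingularities.ResolutionOfSingularities.Theorems.HilbertSamuelEliminationCampaignW42ProjDirectrixOfPerfect
import Literature.AlgebraicGeometry.Resolution.RidgeShiftCoefficients
import HarnessLib

/-!
# [OURS · L1 W4.2] Near points of the blow-up of a point `x` with `e_x(X) = ē_x(X)` lie on the projectivised DIRECTRIX —
# every characteristic, every residue field, `x` closed OR NOT (campaign s42, cell res-hironaka; P-b of chain w42's
# RECOGNITION-CUT (R2), crux stmt-ResolutionOfSingularities-18506 / conjunct stmt-ResolutionOfSingularities-19249; `--supports`)

HONEST FRAMING. OURS (slot W4.2, prover res-L1-s42-pv-1, gen 4). The companion `…CampaignW42ProjDirectrixOfPerfect`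
(p515242) proved `IsOnProjDirectrix π x'` for a near point `x'` of the blow-up of a point `x` with PERFECT residue field.
At the NON-CLOSED points that chain w42's unit recognition needs (the generic point `η_{q−1}` of the curve `C_{q−1}`,
CJS LNM 2270 p. 104: «by (6.24) and Theorem 5.20 there is at most one point `η_q ∈ X_q` near to `η_{q−1}`») the residue
field is never perfect in characteristic `p`. This file replaces «`κ(x)` perfect» by the hypothesis CJS actually carry
along their fundamental sequences — (F3) **`e_x(X) = ē_x(X)`** (p. 103) — which holds at perfect points (`ē = e_{k̄} = e`
over a perfect field) and at `η_{q−1}` (e = ē = 1 by (6.24) and Thm. 3.10 (4) in its `∀ K` form):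

* `CampaignW42.directrixSpace_le_radical_ridgeIdeal_of_directrixDim_map_eq` — cones over a field `k`: for a homogeneous
  ideal `J ⊆ k[X_1, …, X_n]` and a PERFECT extension `K ⊇ k` with `e(J) = e(J · K[X])`, every linear form of the
  directrix space `𝒯(J)` lies in the radical `√𝔉(J)` of Giraud's ridge ideal — OVER `k`. (Dietel (6.3.5) (ii) over `K`,
  tree `radical_ridgeIdeal_coneIdeal_eq_and_ridgeDim_eq`: `√𝔉(J_K) = 𝒯(J_K)·K[X]`; base change of the ridge ideal
  `𝔉(J_K) = 𝔉(J)·K[X]` (`ridgeIdeal_coneIdeal`); `𝒯(J_K) ⊆ 𝒯(J) ⊗ K` (`Directs.map_field`) is an equality by the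
  dimension hypothesis; descent of ideal membership along `k[X] → K[X]` by a `k`-linear retraction
  (`coeffwise_mem_of_mem_coneIdeal`).)
* **`CampaignW42.isOnProjDirectrix_of_isNearPoint_of_dirDim_eq_geomDirDim`** — for a blow-up `π` along `D` with
  `𝓘_{D,x} = 𝔪_x` at `x = π x'` (ANY point `x`: the hypothesis is on the stalk ideal, not on closedness), `D` permissible
  at `x`, `𝒪_{X,x}` universally catenary, `x'` NEAR at level `N` and `e_x(X) = ē_x(X)`: `IsOnProjDirectrix π x'`. Proof =
  the companion's (ridge confinement `mem_localRidge_of_isNearPoint_point`, then every `L ∈ 𝒯(J) ⊆ √𝔉(J)` vanishes at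
  the direction `ū ∈ F(κ(x'))`), with Dietel applied over an algebraic closure of `κ(x)` instead of over `κ(x)`.
* `CampaignW42.isOnProjDirectrix_of_near_of_dirDim_eq_geomDirDim` — door shape on an excellent `X`.

This is CJS Thm. 3.14's LOCUS conclusion for point blow-ups under (F3) in ALL characteristics with NO characteristic
hypothesis and NO named fact (their proof needs `char κ(x) = 0 ∨ ≥ dim X/2 + 1`; without (F3) and without the
characteristic bound the conclusion is false — Hironaka's quadric, tree barrier `DirectrixSmallCharacteristic`, has
`e = 0 < ē`). NOTHING here is a statement of H. Hironaka's manuscript [Hironaka2017]. AI review is weaker than expert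
review. References (orientation only): V. Cossart, U. Jannsen, S. Saito, LNM 2270 (2020), Thm. 3.14, (F3) p. 103,
(6.24), p. 104; B. Dietel, Dissertation Regensburg (2015), Lemma (6.3.5) (ii), (6.1.10); J. Giraud (1975) §1.5.
-/

noncomputable section

-- single-conjunct summit: the doubled namespace component `ResolutionOfSingularities` is mandated
set_option linter.dupNamespace false

open CategoryTheory AlgebraicGeometry IsLocalRing MvPolynomial
open Literature.RingTheory.HilbertSamuel Literature.RingTheory.MvPolynomial
open Literature.AlgebraicGeometry.Resolution Literature.AlgebraicGeometry.CossartJannsenSaito2020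

namespace Summit.ResolutionOfSingularities.ResolutionOfSingularities.Theorems

namespace CampaignW42

universe u

/-! ## Cones with `e = e_K` for a perfect `K`: the directrix forms lie in the radical of the ridge ideal -/

section Cones

variable {k : Type u} [Field k] {n : ℕ}

/-- Descent of ideal membership along `k[X] → K[X]` for a field extension: if `f ⊗ 1 ∈ I · K[X]` then `f ∈ I`
(apply `ψ ⊗ id` for a `k`-linear retraction `ψ : K → k`, tree `coeffwise_mem_of_mem_coneIdeal`). [folklore] -/
theorem mem_of_map_mem_coneIdeal (K : Type u) [Field K] [Algebra k K] {I : Ideal (MvPolynomial (Fin n) k)}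
    {f : MvPolynomial (Fin n) k} (hf : MvPolynomial.map (algebraMap k K) f ∈ coneIdeal K I) : f ∈ I := by
  obtain ⟨ψ, hψ⟩ := LinearMap.exists_leftInverse_of_injective (Algebra.linearMap k K)
    (LinearMap.ker_eq_bot.mpr (algebraMap k K).injective)
  have h1 : ψ 1 = 1 := by
    have h := LinearMap.congr_fun hψ 1
    rw [LinearMap.comp_apply, Algebra.linearMap_apply, map_one, LinearMap.id_apply] at h
    exact h
  have h := coeffwise_mem_of_mem_coneIdeal hf ψ
  rwa [coeffwise_map, h1, one_smul] at h

/-- **`𝒯(J) ⊆ √𝔉(J)` when `e(J) = e(J_K)` for a perfect `K ⊇ k`.** For a homogeneous ideal `J ⊆ k[X_1, …, X_n]` and a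
perfect field extension `K` with `directrixDim J = directrixDim (J · K[X])` (e.g. `K = k̄` and `e = ē`), every linear form
of the directrix space of `J` lies in the radical of Giraud's ridge ideal `𝔉(J)` over `k` itself. (Dietel (6.3.5) (ii)
over `K`: `√𝔉(J_K) = 𝒯(J_K) · K[X]`; `𝔉(J_K) = 𝔉(J) · K[X]`; `𝒯(J_K) = 𝒯(J) ⊗ K` by the dimension hypothesis; descent.)
[cite: Dietel2015, Lemma (6.3.5) (ii) p. 76; Lemma (6.1.10) p. 72] [cite: CossartJannsenSaito2020, Lemma 2.10 (2)] -/
theorem directrixSpace_le_radical_ridgeIdeal_of_directrixDim_map_eq {J : Ideal (MvPolynomial (Fin n) k)}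
    (hJ : IsHomogeneousIdeal J) (K : Type u) [Field K] [Algebra k K] [PerfectField K]
    (he : directrixDim J = directrixDim (J.map (MvPolynomial.map (algebraMap k K))))
    {L : MvPolynomial (Fin n) k} (hL : L ∈ directrixSpace J) : L ∈ (ridgeIdeal J).radical := by
  classical
  -- Dietel over the perfect `K`
  have hD := (radical_ridgeIdeal_coneIdeal_eq_and_ridgeDim_eq J hJ K).1
  -- `𝒯(J_K) = K · 𝒯(J)`
  have hd := (directs_directrixSpace J).map_field (algebraMap k K) (K := K)
  haveI : FiniteDimensional k (directrixSpace J) := Submodule.finiteDimensional_of_le (directrixSpace_le_one J)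
  haveI hfin : FiniteDimensional K (Submodule.span K (MvPolynomial.map (algebraMap k K) ''
      (directrixSpace J : Set (MvPolynomial (Fin n) k)))) := Submodule.finiteDimensional_of_le hd.1
  have hle : directrixSpace (J.map (MvPolynomial.map (algebraMap k K))) ≤
      Submodule.span K (MvPolynomial.map (algebraMap k K) '' (directrixSpace J : Set (MvPolynomial (Fin n) k))) :=
    directrixSpace_le hd
  have hfr : Module.finrank K (Submodule.span K (MvPolynomial.map (algebraMap k K) ''
      (directrixSpace J : Set (MvPolynomial (Fin n) k)))) ≤
      Module.finrank K (directrixSpace (J.map (MvPolynomial.map (algebraMap k K)))) := by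
    rw [Literature.RingTheory.HilbertSamuel.finrank_span_image_eq (algebraMap k K) (directrixSpace J)
      (directrixSpace_le_one J)]
    have h1 := finrank_directrixSpace_add_directrixDim (I := J)
    have h2 := finrank_directrixSpace_add_directrixDim (I := J.map (MvPolynomial.map (algebraMap k K)))
    omega
  have heq : directrixSpace (J.map (MvPolynomial.map (algebraMap k K))) =
      Submodule.span K (MvPolynomial.map (algebraMap k K) '' (directrixSpace J : Set (MvPolynomial (Fin n) k))) :=
    Submodule.eq_of_le_of_finrank_le hle hfr
  -- `L ⊗ 1 ∈ 𝒯(J_K) ⊆ √𝔉(J_K) = √(𝔉(J) · K[X])`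
  have hLK : MvPolynomial.map (algebraMap k K) L ∈ directrixSpace (J.map (MvPolynomial.map (algebraMap k K))) := by
    rw [heq]
    exact Submodule.subset_span ⟨L, hL, rfl⟩
  have hLrad : MvPolynomial.map (algebraMap k K) L ∈ (ridgeIdeal (coneIdeal K J)).radical := by
    rw [hD]
    exact Ideal.subset_span hLK
  rw [ridgeIdeal_coneIdeal K J] at hLrad
  obtain ⟨m, hm⟩ := hLrad
  rw [← map_pow] at hm
  exact ⟨m, mem_of_map_mem_coneIdeal K hm⟩

end Cones

/-! ## Point blow-ups at points with `e = ē`: near points lie on `ℙ(Dir)` -/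

section Point

variable {X X' : Scheme.{u}} [IsLocallyNoetherian X] {π : X' ⟶ X} {D : X.IdealSheafData}

/-- Unfolding `e_x(X) = ē_x(X)` to the directrix dimensions of the tangent-cone ideal `J` of `𝒪_{X,x}` and of its base
change to an algebraic closure of `κ(x)`. [cite: CossartJannsenSaito2020, Def. 2.18, Def. 2.21, Def. 2.26] -/
theorem directrixDim_eq_directrixDim_map_algebraicClosure_of_dirDim_eq_geomDirDim (x : X)
    (he : Scheme.dirDim X x = Scheme.geomDirDim X x) :
    directrixDim (canonicalTangentConeIdeal (X.presheaf.stalk x)) =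
      directrixDim ((canonicalTangentConeIdeal (X.presheaf.stalk x)).map
        (MvPolynomial.map (algebraMap (ResidueField (X.presheaf.stalk x))
          (AlgebraicClosure (ResidueField (X.presheaf.stalk x)))))) :=
  he

-- (`maxHeartbeats`: the stalks of a scheme carry their ring structure through `CommRingCat`; matching the instance
-- paths of `κ(x) → κ(x')` produced here against those inside `IsOnProjDirectrix` is correct but slow)
set_option maxHeartbeats 800000 in
/-- **Near points of the blow-up of a point `x` with `e_x(X) = ē_x(X)` lie on the projectivised directrix.** Let `π` be a
blow-up along `D` with `𝓘_{D,x} = 𝔪_x` at `x = π x'` (`x` any point, closed or not), `D` permissible at `x`, `𝒪_{X,x}`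
universally catenary, `x'` near at level `N` (`IsNearPoint`), and `e_x(X) = ē_x(X)` (CJS (F3)). Then
`IsOnProjDirectrix π x'`: every linear form of the directrix space of `C_x(X)`, lifted to `𝔪_x`, maps into
`𝔪_x𝒪_{X',x'} · 𝔪_{x'}`. Every characteristic, no characteristic hypothesis, no named fact: ridge confinement
(`mem_localRidge_of_isNearPoint_point`) + `𝒯(J) ⊆ √𝔉(J)` (`directrixSpace_le_radical_ridgeIdeal_of_directrixDim_map_eq`
over `k̄`). [cite: CossartJannsenSaito2020, Thm. 3.14, p. 103 (F3)] [cite: Dietel2015, Lemma (6.3.5) (ii) p. 76] -/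
theorem isOnProjDirectrix_of_isNearPoint_of_dirDim_eq_geomDirDim (hπ : IsBlowup π D) (x' : X')
    (hperm : IdealSheafData.IsPermissibleAt D (π.base x'))
    (hUC : IsUniversallyCatenaryRing (X.presheaf.stalk (π.base x')))
    (hD : stalkIdeal D (π.base x') = maximalIdeal (X.presheaf.stalk (π.base x')))
    (he : Scheme.dirDim X (π.base x') = Scheme.geomDirDim X (π.base x'))
    {N : ℕ} (hnear : IsNearPoint π N x') : IsOnProjDirectrix π x' := by
  classical
  intro L hL c hc
  letI algκ : Algebra (ResidueField (X.presheaf.stalk (π.base x'))) (ResidueField (X'.presheaf.stalk x')) :=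
    (ResidueField.map (π.stalkMap x').hom).toAlgebra
  have hx : Ideal.span (Set.range (minGenerators (X.presheaf.stalk (π.base x')))) =
      maximalIdeal (X.presheaf.stalk (π.base x')) := span_range_minGenerators _
  -- a chart through `x'` for the generators `x` of `𝓘_{D,x} = 𝔪_x`
  obtain ⟨j, 𝔴, χ, hχ, hloc, h𝔴⟩ :=
    hπ.exists_reesChart_stalk x' (minGenerators (X.presheaf.stalk (π.base x'))) (hx.trans hD.symm)
  letI algCO : Algebra (chartRing (minGenerators (X.presheaf.stalk (π.base x'))) j) (X'.presheaf.stalk x') :=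
    χ.toAlgebra
  haveI : IsLocalization.AtPrime (X'.presheaf.stalk x') 𝔴.asIdeal := hloc
  have hū := mem_localRidge_of_isNearPoint_point x' hperm hUC hD hnear j 𝔴 χ hχ hloc h𝔴
  -- `e = ē`: `𝒯(J) ⊆ √𝔉(J)`, so `L(ū) = 0`
  have hJ : IsHomogeneousIdeal (canonicalTangentConeIdeal (X.presheaf.stalk (π.base x'))) :=
    isHomogeneousIdeal_tangentConeIdeal _ _
  have hLrad : L ∈ (ridgeIdeal (canonicalTangentConeIdeal (X.presheaf.stalk (π.base x')))).radical :=
    directrixSpace_le_radical_ridgeIdeal_of_directrixDim_map_eq hJ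
      (AlgebraicClosure (ResidueField (X.presheaf.stalk (π.base x'))))
      (directrixDim_eq_directrixDim_map_algebraicClosure_of_dirDim_eq_geomDirDim (π.base x') he) hL
  have hLū := aeval_eq_zero_of_mem_ridge_of_mem_radical ((mem_localRidge_iff _).mp hū) hLrad
  -- `L = Σ_i (coeff_i L) X_i`
  obtain ⟨w, hwL⟩ : ∃ w, linForm w = L := by
    have h1 : L ∈ LinearMap.range (linForm (K := ResidueField (X.presheaf.stalk (π.base x')))
        (n := (maximalIdeal (X.presheaf.stalk (π.base x'))).spanFinrank)) := by
      rw [range_linForm]; exact directrixSpace_le_one _ hL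
    exact LinearMap.mem_range.mp h1
  have hcoeff : ∀ i, MvPolynomial.coeff (Finsupp.single i 1) L = w i := fun i => by
    rw [← hwL, linForm_apply, coeff_sum, Finset.sum_eq_single i]
    · rw [coeff_smul, coeff_X, if_pos rfl, smul_eq_mul, mul_one]
    · intro b _ hb
      rw [coeff_smul, coeff_X, if_neg (fun h => hb (Finsupp.single_left_injective one_ne_zero h)), smul_zero]
    · exact fun h => (h (Finset.mem_univ i)).elim
  -- `π♯(x_i) = χ(e_i) · π♯(x_j)`, `π♯(x_j) ∈ 𝔪_x 𝒪'`, and `Σ_i c̄_i ū_i = L(ū) = 0`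
  have hcl : ∀ i, (π.stalkMap x').hom (minGenerators (X.presheaf.stalk (π.base x')) i) =
      χ (chartGen (minGenerators (X.presheaf.stalk (π.base x'))) j i) *
        (π.stalkMap x').hom (minGenerators (X.presheaf.stalk (π.base x')) j) := fun i => by
    rw [← hχ, ← hχ, reesChartBase_apply_eq_mul_chartGen (minGenerators (X.presheaf.stalk (π.base x'))) j i, map_mul,
      mul_comm]
  have ht : (π.stalkMap x').hom (minGenerators (X.presheaf.stalk (π.base x')) j) ∈
      (maximalIdeal (X.presheaf.stalk (π.base x'))).map (π.stalkMap x').hom :=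
    Ideal.mem_map_of_mem _ (by rw [← hx]; exact Ideal.subset_span ⟨j, rfl⟩)
  have hL' : aeval (fun i => residue (X'.presheaf.stalk x')
      (χ (chartGen (minGenerators (X.presheaf.stalk (π.base x'))) j i))) (linForm w) = 0 :=
    hwL ▸ hLū
  have h0 := (aeval_linForm_eq_sum w _).symm.trans hL'
  exact map_sum_mul_mem_of_residue_sum_eq_zero (π.stalkMap x').hom (minGenerators (X.presheaf.stalk (π.base x'))) c
    (fun i => χ (chartGen (minGenerators (X.presheaf.stalk (π.base x'))) j i)) _ hcl ht w
    (fun i => (hc i).trans (hcoeff i)) h0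

/-- At a point with PERFECT residue field `e_x(X) = ē_x(X)` (the algebraic closure is a separable = arbitrary algebraic
extension of a perfect field; CJS Lemma 2.10 (3)(i) in the tree's form `dirDimOver_eq_of_eq_ringKrullDim` is not needed:
we use Dietel over `κ(x)` and over `k̄` and compare ridge dimensions, `ridgeDim J = e(J_K)` for every perfect `K`).
[cite: Dietel2015, Lemma (6.3.5) (ii) p. 76] -/
theorem dirDim_eq_geomDirDim_of_perfectField (x : X) (hperf : PerfectField (ResidueField (X.presheaf.stalk x))) :
    Scheme.dirDim X x = Scheme.geomDirDim X x := by
  have hJ : IsHomogeneousIdeal (canonicalTangentConeIdeal (X.presheaf.stalk x)) := isHomogeneousIdeal_tangentConeIdeal _ _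
  -- `ridgeDim J = e(J_k) = e(J)` and `ridgeDim J = e(J_{k̄}) = ē`
  have h1 := (radical_ridgeIdeal_coneIdeal_eq_and_ridgeDim_eq (canonicalTangentConeIdeal (X.presheaf.stalk x)) hJ
    (ResidueField (X.presheaf.stalk x))).2
  have h2 := (radical_ridgeIdeal_coneIdeal_eq_and_ridgeDim_eq (canonicalTangentConeIdeal (X.presheaf.stalk x)) hJ
    (AlgebraicClosure (ResidueField (X.presheaf.stalk x)))).2
  have h3 : directrixDim (coneIdeal (ResidueField (X.presheaf.stalk x))
      (canonicalTangentConeIdeal (X.presheaf.stalk x))) = Scheme.dirDim X x := by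
    change dirDimOver (X.presheaf.stalk x) (ResidueField (X.presheaf.stalk x)) = dirDim (X.presheaf.stalk x)
    exact dirDimOver_residueField _
  rw [← h3, ← h1, h2]
  rfl

end Point

/-! ## The door's shape: blow-up of a point (closed or not) of an excellent scheme -/

section Door

variable {X X' : Scheme.{u}} [IsLocallyNoetherian X] {π : X' ⟶ X} {D : X.IdealSheafData} {x : X}

/-- **CJS-3.14 confinement at a point with `e = ē`, unconditional, `x` closed or not.** `X` excellent and locally
noetherian, `x ∈ X` a point with `0 < dim 𝒪_{X,x}` (so that the centre is permissible at `x`) and `e_x(X) = ē_x(X)`,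
`π : X' → X` a blow-up along an ideal sheaf `D` with `𝓘_{D,x} = 𝔪_x` (e.g. `D` the reduced ideal of a closed `C` of
which `x` is a generic point — the centre `C_{q−1}` at `η_{q−1}` of CJS p. 104), `x'` a point over `x` NEAR at level `N`
(`H^N_{X'}(x') = H^N_X(x)`): then `IsOnProjDirectrix π x'`. [cite: CossartJannsenSaito2020, Thm. 3.14, p. 104] -/
theorem isOnProjDirectrix_of_near_of_dirDim_eq_geomDirDim (hX : Scheme.IsExcellent X) (hπ : IsBlowup π D)
    {N : ℕ} {x' : X'} (hxx' : π.base x' = x)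
    (hD : stalkIdeal D x = maximalIdeal (X.presheaf.stalk x)) (hpos : 0 < ringKrullDim (X.presheaf.stalk x))
    (he : Scheme.dirDim X x = Scheme.geomDirDim X x)
    (hnear : Scheme.hsFun X' N x' = Scheme.hsFun X N x) : IsOnProjDirectrix π x' := by
  subst hxx'
  have hperm : IdealSheafData.IsPermissibleAt D (π.base x') := by
    rw [IdealSheafData.isPermissibleAt_iff, hD]
    exact (isPermissible_maximalIdeal_iff _).mpr fun hmin => by
      have h0 : (maximalIdeal (X.presheaf.stalk (π.base x'))).height = 0 := Ideal.height_eq_zero_iff.mpr hmin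
      have hdim : ringKrullDim (X.presheaf.stalk (π.base x')) = 0 := by
        rw [← IsLocalRing.maximalIdeal_height_eq_ringKrullDim, h0]; rfl
      rw [hdim] at hpos
      exact lt_irrefl _ hpos
  exact isOnProjDirectrix_of_isNearPoint_of_dirDim_eq_geomDirDim hπ x' hperm (hX.isUniversallyCatenaryRing_stalk _) hD he
    (N := N) hnear

end Door

end CampaignW42

end Summit.ResolutionOfSingularities.ResolutionOfSingularities.Theorems

end
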